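import Summits.Parity.GeneralizedHardyLittlewood.Theorems.BeyondDiagonalBeatsQuarter.OffDiagLevelLargeSieve
import Summits.Parity.GeneralizedHardyLittlewood.Theorems.BeyondDiagonalBeatsQuarter.OffDiagLevelSeparation
import HarnessLib

/-!
# Route `PrimeLevelFamEdge`, crux K_B (stmt-Parity-20343), line `diagonal_kernel_split` rev 4, plan Ω,
# node L7 (OMEGA-BLUEPRINT v4 §3c) bookkeeping `OffDiagLevelSubBlocks`: **the level block cut into `T` consecutive
# sub-blocks — the large-conductor parts split additively, E18 holds per sub-block with `N′ = N/T + 1`, and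
# Cauchy–Schwarz across the blocks costs exactly `√T`**

The q-separation of the dual weights (L7c, `OffDiagLevelSeparation`: Taylor in the level variable with geometric
coefficients) needs sub-blocks of relative length `≍ 1/(2B)` where `B` is the cost of one `q∂_q`; in the oscillatory
layers `B ≍ Z·q^{ε}` (prover-6's CHECK input (α), line lead 2026-08-28T16:34:22Z: «oscillatory layers need q-sub-blocks
of length `N/(Z q^{ε})`; E18 per sub-block keeps the `N`-term `2(N′+1)/R` and the `4Q` term, CS across `≤ 2Zq^{ε}` blocks
loses `≤ (2Zq^{ε})^{1/2}`»). This file is that bookkeeping, on top of prover-8's block decomposition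
`LevelSeparation.sum_Ioc_eq_sum_blocks` (breakpoints `M₀ + ⌊iN/T⌋`) and prover-7's weighted Cauchy–Schwarz form of E18
`OffDiag.norm_sum_moduli_sum_coprime_mul_levelLargePart_le`:

* §1 `sum_eq_sum_blocks_filter` (a sum over `G ⊆ (M₀, M₀+N]` is the sum over its `T` sub-block pieces
  `G ∩ B_i`, `B_i = (M₀ + ⌊iN/T⌋, M₀ + ⌊(i+1)N/T⌋]`), `filter_block_subset_Ioc` (`G ∩ B_i ⊆ (M₀ᵢ, M₀ᵢ + (N/T + 1)]`),
  coprimality/primality inherited by the pieces;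
* §2 additivity of the level objects in the level set: `levelAPSum_eq_sum_blocks`, `levelLargePart_eq_sum_blocks`,
  `levelSmallPart_eq_sum_blocks` (`levelLargePart R G F h c = Σ_{i<T} levelLargePart R (G ∩ B_i) F h c`, exact);
* §3 `sum_sqrt_le_sqrt_card_mul_sqrt_sum` (`Σ_{i∈s} √S_i ≤ √#s·√(Σ S_i)`), `norm_sum_blocks_le` (per-block bounds
  `‖X_i‖ ≤ A·(Σ_{G∩B_i} Φ²)^{1/2}` sum to `‖Σ_i X_i‖ ≤ A·√T·(Σ_G Φ²)^{1/2}`);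
* §4 **`norm_sum_blocks_moduli_coprime_mul_levelLargePart_le`**: for block-DEPENDENT class weights `W_i(h,c)` with
  `Σ_{h ≤ H}Σ_{c reduced}‖W_i(h,c)‖² ≤ 𝒲²` and block-dependent level weights `‖F_i(q)‖ ≤ Φ(q)` on `G`,
  `‖Σ_{i<T} Σ_{h ≤ H} Σ_{c} W_i(h,c)·levelLargePart R (G ∩ B_i) F_i h c‖
     ≤ 𝒲·(1 + log H)·(2((N/T+1)+1)/R + 4H)^{1/2}·√T·(Σ_{q∈G} Φ(q)²)^{1/2}`
  (`G ⊆ (M₀, M₀+N]` coprime to all moduli `≤ H`, `1 ≤ R`, `1 ≤ T`), and the prime-level form `…_of_subset_primes`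
  (`G ⊆` primes of `(N₀, 2N₀]`, `H ≤ N₀`).
After L7c each `F_i` is a universal sequence `((q − t₀⁽ⁱ⁾)/ℓ)^j·𝟙` with `Φ = 1`, so the last factor is `√#G`; the
saving against the trivial mass stays `≍ (T·N′/(R·N))^{1/2}·polylog = R^{−1/2}·polylog` as long as `4H ≤ 2N′/R`.
Bookkeeping only; no def; helper toward `stub_offDiagBelowSlack_io` (`--supports stmt-Parity-20343`); closes nothing;
standard axioms.
«The programme SEARCHES and TYPES; no claim about Landau–Siegel zeros, Theorems 1–2 of arXiv:2211.02515 or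
a repaired Margin232 until a kernel theorem says so.»
-/

noncomputable section

namespace Summit.Parity.GeneralizedHardyLittlewood.Theorems.BeyondDiagonalBeatsQuarter.OffDiag

open Finset
open LevelSeparation (sum_Ioc_eq_sum_blocks block_length_le blockEnd_le)

/-! ### §1. The pieces `G ∩ B_i` of a level set -/

section Blocks

variable {M₀ N T : ℕ} {G : Finset ℕ}

/-- **A sum over `G ⊆ (M₀, M₀+N]` is the sum over its sub-block pieces**: for `T ≥ 1`,
`Σ_{q∈G} g q = Σ_{i<T} Σ_{q ∈ G, q ∈ (M₀+⌊iN/T⌋, M₀+⌊(i+1)N/T⌋]} g q`. [folklore] -/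
theorem sum_eq_sum_blocks_filter {M : Type*} [AddCommMonoid M] (hG : G ⊆ Ioc M₀ (M₀ + N)) (hT : 1 ≤ T)
    (g : ℕ → M) :
    ∑ q ∈ G, g q = ∑ i ∈ range T,
      ∑ q ∈ G.filter (fun q : ℕ => q ∈ Ioc (M₀ + i * N / T) (M₀ + (i + 1) * N / T)), g q := by
  classical
  have h1 : ∑ q ∈ G, g q = ∑ q ∈ Ioc M₀ (M₀ + N), if q ∈ G then g q else 0 := by
    rw [← Finset.sum_filter]
    congr 1
    ext q
    simp only [Finset.mem_filter, Finset.mem_Ioc]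
    constructor
    · intro hq
      exact ⟨Finset.mem_Ioc.1 (hG hq), hq⟩
    · exact fun hq => hq.2
  rw [h1, sum_Ioc_eq_sum_blocks _ M₀ N hT]
  refine Finset.sum_congr rfl fun i _ => ?_
  rw [← Finset.sum_filter]
  congr 1
  ext q
  simp only [Finset.mem_filter]
  exact and_comm

/-- Each sub-block sits in an interval of length `N/T + 1` starting at its left breakpoint:
`(M₀+⌊iN/T⌋, M₀+⌊(i+1)N/T⌋] ⊆ (M₀ᵢ, M₀ᵢ + (N/T + 1)]`, `M₀ᵢ = M₀ + ⌊iN/T⌋`. [folklore] -/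
theorem block_subset_Ioc (M₀ N T i : ℕ) :
    Ioc (M₀ + i * N / T) (M₀ + (i + 1) * N / T) ⊆ Ioc (M₀ + i * N / T) (M₀ + i * N / T + (N / T + 1)) := by
  refine Finset.Ioc_subset_Ioc le_rfl ?_
  have := block_length_le N T i
  have hmono : i * N / T ≤ (i + 1) * N / T := Nat.div_le_div_right (Nat.mul_le_mul_right N (by omega))
  omega

/-- The piece `G ∩ B_i` lies in `(M₀ᵢ, M₀ᵢ + (N/T + 1)]` — the `hQ` hypothesis of the per-block large sieve with
`N′ = N/T + 1`. [folklore] -/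
theorem filter_block_subset_Ioc (G : Finset ℕ) (M₀ N T i : ℕ) :
    G.filter (fun q : ℕ => q ∈ Ioc (M₀ + i * N / T) (M₀ + (i + 1) * N / T)) ⊆
      Ioc (M₀ + i * N / T) (M₀ + i * N / T + (N / T + 1)) :=
  fun _ hq => block_subset_Ioc M₀ N T i (Finset.mem_filter.1 hq).2

/-- Coprimality to the moduli is inherited by the pieces. [folklore] -/
theorem coprime_of_filter_block {H : ℕ} (hcop : ∀ q ∈ G, ∀ h ∈ Icc 1 H, Nat.Coprime q h) (p : ℕ → Prop)
    [DecidablePred p] : ∀ q ∈ G.filter p, ∀ h ∈ Icc 1 H, Nat.Coprime q h :=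
  fun q hq h hh => hcop q (Finset.mem_filter.1 hq).1 h hh

end Blocks

/-! ### §2. The level objects are additive in the level set -/

section Additive

variable {M₀ N T : ℕ} {G : Finset ℕ} {n : ℕ}

/-- **The class sum splits over the sub-blocks**: `levelAPSum G F n a = Σ_{i<T} levelAPSum (G ∩ B_i) F n a`.
[folklore] -/
theorem levelAPSum_eq_sum_blocks (hG : G ⊆ Ioc M₀ (M₀ + N)) (hT : 1 ≤ T) (F : ℕ → ℂ) (a : ZMod n) :
    levelAPSum G F n a = ∑ i ∈ range T,
      levelAPSum (G.filter (fun q : ℕ => q ∈ Ioc (M₀ + i * N / T) (M₀ + (i + 1) * N / T))) F n a := by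
  classical
  unfold levelAPSum
  rw [sum_eq_sum_blocks_filter ((Finset.filter_subset _ G).trans hG) hT]
  refine Finset.sum_congr rfl fun i _ => ?_
  rw [Finset.filter_filter, Finset.filter_filter]
  exact Finset.sum_congr (Finset.filter_congr fun q _ => and_comm) fun _ _ => rfl

/-- **The large-conductor part splits over the sub-blocks**:
`levelLargePart R G F n a = Σ_{i<T} levelLargePart R (G ∩ B_i) F n a` (exact). [folklore] -/
theorem levelLargePart_eq_sum_blocks (hG : G ⊆ Ioc M₀ (M₀ + N)) (hT : 1 ≤ T) (R : ℕ) (F : ℕ → ℂ)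
    (a : ZMod n) :
    levelLargePart R G F n a = ∑ i ∈ range T,
      levelLargePart R (G.filter (fun q : ℕ => q ∈ Ioc (M₀ + i * N / T) (M₀ + (i + 1) * N / T))) F n a := by
  classical
  unfold levelLargePart
  rw [← Finset.mul_sum, Finset.sum_comm]
  congr 1
  refine Finset.sum_congr rfl fun χ _ => ?_
  rw [← Finset.mul_sum, sum_eq_sum_blocks_filter hG hT]

/-- **The small-conductor part splits over the sub-blocks**:
`levelSmallPart R G F n a = Σ_{i<T} levelSmallPart R (G ∩ B_i) F n a` (exact). [folklore] -/
theorem levelSmallPart_eq_sum_blocks (hG : G ⊆ Ioc M₀ (M₀ + N)) (hT : 1 ≤ T) (R : ℕ) (F : ℕ → ℂ)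
    (a : ZMod n) :
    levelSmallPart R G F n a = ∑ i ∈ range T,
      levelSmallPart R (G.filter (fun q : ℕ => q ∈ Ioc (M₀ + i * N / T) (M₀ + (i + 1) * N / T))) F n a := by
  classical
  unfold levelSmallPart
  rw [← Finset.mul_sum, Finset.sum_comm]
  congr 1
  refine Finset.sum_congr rfl fun χ _ => ?_
  rw [← Finset.mul_sum, sum_eq_sum_blocks_filter hG hT]

end Additive

/-! ### §3. Cauchy–Schwarz across the blocks -/

section AcrossBlocks

/-- `Σ_{i∈s} √S_i ≤ √#s · √(Σ_{i∈s} S_i)` for `S ≥ 0` (Cauchy–Schwarz with the constant sequence). [folklore] -/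
theorem sum_sqrt_le_sqrt_card_mul_sqrt_sum {ι : Type*} (s : Finset ι) (S : ι → ℝ) (hS : ∀ i ∈ s, 0 ≤ S i) :
    ∑ i ∈ s, Real.sqrt (S i) ≤ Real.sqrt s.card * Real.sqrt (∑ i ∈ s, S i) := by
  have h := Real.sum_mul_le_sqrt_mul_sqrt s (fun _ => (1 : ℝ)) (fun i => Real.sqrt (S i))
  have h1 : ∑ i ∈ s, (1 : ℝ) * Real.sqrt (S i) = ∑ i ∈ s, Real.sqrt (S i) :=
    Finset.sum_congr rfl fun i _ => one_mul _
  have h2 : ∑ i ∈ s, (1 : ℝ) ^ 2 = s.card := by simp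
  have h3 : ∑ i ∈ s, Real.sqrt (S i) ^ 2 = ∑ i ∈ s, S i :=
    Finset.sum_congr rfl fun i hi => Real.sq_sqrt (hS i hi)
  rw [h1, h2, h3] at h
  exact h

variable {M₀ N T : ℕ} {G : Finset ℕ}

/-- **Per-block bounds sum with the loss `√T`**: if `‖X_i‖ ≤ A·(Σ_{q ∈ G∩B_i} Φ(q)²)^{1/2}` for every `i < T`
(`A ≥ 0`), then `‖Σ_{i<T} X_i‖ ≤ A·√T·(Σ_{q∈G} Φ(q)²)^{1/2}`. [folklore] -/
theorem norm_sum_blocks_le (hG : G ⊆ Ioc M₀ (M₀ + N)) (hT : 1 ≤ T) {X : ℕ → ℂ} {A : ℝ} (hA : 0 ≤ A)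
    (Φ : ℕ → ℝ)
    (hX : ∀ i ∈ range T, ‖X i‖ ≤ A * Real.sqrt (∑ q ∈ G.filter
      (fun q : ℕ => q ∈ Ioc (M₀ + i * N / T) (M₀ + (i + 1) * N / T)), Φ q ^ 2)) :
    ‖∑ i ∈ range T, X i‖ ≤ A * Real.sqrt T * Real.sqrt (∑ q ∈ G, Φ q ^ 2) := by
  classical
  set S : ℕ → ℝ := fun i => ∑ q ∈ G.filter
    (fun q : ℕ => q ∈ Ioc (M₀ + i * N / T) (M₀ + (i + 1) * N / T)), Φ q ^ 2 with hSdef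
  have hS0 : ∀ i ∈ range T, 0 ≤ S i := fun i _ => Finset.sum_nonneg fun q _ => sq_nonneg _
  have htot : ∑ i ∈ range T, S i = ∑ q ∈ G, Φ q ^ 2 := (sum_eq_sum_blocks_filter hG hT _).symm
  calc ‖∑ i ∈ range T, X i‖ ≤ ∑ i ∈ range T, ‖X i‖ := norm_sum_le _ _
    _ ≤ ∑ i ∈ range T, A * Real.sqrt (S i) := Finset.sum_le_sum hX
    _ = A * ∑ i ∈ range T, Real.sqrt (S i) := by rw [Finset.mul_sum]
    _ ≤ A * (Real.sqrt (range T).card * Real.sqrt (∑ i ∈ range T, S i)) :=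
        mul_le_mul_of_nonneg_left (sum_sqrt_le_sqrt_card_mul_sqrt_sum _ S hS0) hA
    _ = A * Real.sqrt T * Real.sqrt (∑ q ∈ G, Φ q ^ 2) := by rw [Finset.card_range, htot, mul_assoc]

end AcrossBlocks

/-! ### §4. The large-conductor parts over all moduli, block by block -/

section LargeSieveBlocks

variable {M₀ N T R H : ℕ} {G : Finset ℕ}

/-- **E18 block by block with block-dependent weights.** Levels `G ⊆ (M₀, M₀+N]` coprime to every modulus `≤ H`,
`1 ≤ R`, `1 ≤ T`; class weights `W_i(h, c)` depending on the block with a uniform `ℓ²` bound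
`Σ_{h ≤ H} Σ_{c < h, (c,h)=1} ‖W_i(h,c)‖² ≤ 𝒲²` (`𝒲 ≥ 0`); level weights `F_i` depending on the block with a common
majorant `‖F_i(q)‖ ≤ Φ(q)` on `G`. Then
`‖Σ_{i<T} Σ_{h ≤ H} Σ_{c} W_i(h,c)·levelLargePart R (G∩B_i) F_i h c‖
   ≤ 𝒲·(1 + log H)·(2((N/T+1)+1)/R + 4H)^{1/2}·√T·(Σ_{q∈G} Φ(q)²)^{1/2}`
(per block: `norm_sum_moduli_sum_coprime_mul_levelLargePart_le` with `N′ = N/T + 1`; then `norm_sum_blocks_le`).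
[cite: Davenport1980, ch. 29 — derivation; IwaniecKowalski2004, §17.3 — derivation] -/
theorem norm_sum_blocks_moduli_coprime_mul_levelLargePart_le (hR : 1 ≤ R) (hG : G ⊆ Ioc M₀ (M₀ + N))
    (hcop : ∀ q ∈ G, ∀ h ∈ Icc 1 H, Nat.Coprime q h) (hT : 1 ≤ T) (W : ℕ → ℕ → ℕ → ℂ) {𝒲 : ℝ}
    (h𝒲 : 0 ≤ 𝒲)
    (hW : ∀ i ∈ range T, ∑ h ∈ Icc 1 H, ∑ c ∈ (range h).filter (fun c => c.Coprime h), ‖W i h c‖ ^ 2 ≤ 𝒲 ^ 2)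
    (F : ℕ → ℕ → ℂ) (Φ : ℕ → ℝ) (hF : ∀ i ∈ range T, ∀ q ∈ G, ‖F i q‖ ≤ Φ q) :
    ‖∑ i ∈ range T, ∑ h ∈ Icc 1 H, ∑ c ∈ (range h).filter (fun c => c.Coprime h),
        W i h c * levelLargePart R (G.filter
          (fun q : ℕ => q ∈ Ioc (M₀ + i * N / T) (M₀ + (i + 1) * N / T))) (F i) h (c : ZMod h)‖ ≤
      𝒲 * ((1 + Real.log H) * Real.sqrt (2 * ((((N / T + 1 : ℕ)) : ℝ) + 1) / R + 4 * H)) *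
        Real.sqrt T * Real.sqrt (∑ q ∈ G, Φ q ^ 2) := by
  classical
  have hlog : 0 ≤ 1 + Real.log H := by have := Real.log_natCast_nonneg H; linarith
  have hA : 0 ≤ 𝒲 * ((1 + Real.log H) * Real.sqrt (2 * ((((N / T + 1 : ℕ)) : ℝ) + 1) / R + 4 * H)) := by
    positivity
  refine norm_sum_blocks_le hG hT hA Φ fun i hi => ?_
  set Gi := G.filter (fun q : ℕ => q ∈ Ioc (M₀ + i * N / T) (M₀ + (i + 1) * N / T)) with hGi
  -- the per-block large sieve with `N′ = N/T + 1`
  have hQ : Gi ⊆ Ioc (M₀ + i * N / T) (M₀ + i * N / T + (N / T + 1)) := filter_block_subset_Ioc G M₀ N T i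
  have hcopi : ∀ q ∈ Gi, ∀ h ∈ Icc 1 H, Nat.Coprime q h := coprime_of_filter_block hcop _
  have h1 := norm_sum_moduli_sum_coprime_mul_levelLargePart_le Gi (F i) hR hQ hcopi (W i)
  -- the two block-dependent factors against their uniform bounds
  have h2 : Real.sqrt (∑ h ∈ Icc 1 H, ∑ c ∈ (range h).filter (fun c => c.Coprime h), ‖W i h c‖ ^ 2) ≤ 𝒲 := by
    rw [← Real.sqrt_sq h𝒲]
    exact Real.sqrt_le_sqrt (hW i hi)
  have h3 : Real.sqrt (∑ q ∈ Gi, ‖F i q‖ ^ 2) ≤ Real.sqrt (∑ q ∈ Gi, Φ q ^ 2) := by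
    refine Real.sqrt_le_sqrt (Finset.sum_le_sum fun q hq => ?_)
    exact pow_le_pow_left₀ (norm_nonneg _) (hF i hi q (Finset.mem_filter.1 hq).1) 2
  refine h1.trans ?_
  have hc0 : 0 ≤ (1 + Real.log H) * Real.sqrt (2 * ((((N / T + 1 : ℕ)) : ℝ) + 1) / R + 4 * H) := by
    positivity
  calc Real.sqrt (∑ h ∈ Icc 1 H, ∑ c ∈ (range h).filter (fun c => c.Coprime h), ‖W i h c‖ ^ 2) *
        ((1 + Real.log H) * Real.sqrt (2 * ((((N / T + 1 : ℕ)) : ℝ) + 1) / R + 4 * H) *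
          Real.sqrt (∑ q ∈ Gi, ‖F i q‖ ^ 2))
      ≤ 𝒲 * ((1 + Real.log H) * Real.sqrt (2 * ((((N / T + 1 : ℕ)) : ℝ) + 1) / R + 4 * H) *
          Real.sqrt (∑ q ∈ Gi, Φ q ^ 2)) := by
        refine mul_le_mul h2 (mul_le_mul_of_nonneg_left h3 hc0) (by positivity) h𝒲
    _ = 𝒲 * ((1 + Real.log H) * Real.sqrt (2 * ((((N / T + 1 : ℕ)) : ℝ) + 1) / R + 4 * H)) *
          Real.sqrt (∑ q ∈ Gi, Φ q ^ 2) := by ring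

/-- **Prime levels, block by block**: for `G ⊆` the primes of `(N₀, 2N₀]` (e.g. `goodPrimes Δ′ N₀`), moduli
`≤ H ≤ N₀`, `1 ≤ R`, `1 ≤ T`, block-dependent class weights with `‖W_i‖₂ ≤ 𝒲` and level weights `‖F_i‖ ≤ Φ`:
`‖Σ_{i<T} Σ_{h ≤ H} Σ_c W_i(h,c)·levelLargePart R (G∩B_i) F_i h c‖
   ≤ 𝒲·(1 + log H)·(2((N₀/T+1)+1)/R + 4H)^{1/2}·√T·(Σ_{q∈G} Φ(q)²)^{1/2}`
(sub-blocks `B_i = (N₀ + ⌊iN₀/T⌋, N₀ + ⌊(i+1)N₀/T⌋]`). [cite: Davenport1980, ch. 29 — derivation;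
IwaniecKowalski2004, §17.3 — derivation] -/
theorem norm_sum_blocks_moduli_coprime_mul_levelLargePart_le_of_subset_primes {N₀ : ℕ} (hR : 1 ≤ R)
    (hG : G ⊆ (Ioc N₀ (2 * N₀)).filter Nat.Prime) (hH : H ≤ N₀) (hT : 1 ≤ T) (W : ℕ → ℕ → ℕ → ℂ)
    {𝒲 : ℝ} (h𝒲 : 0 ≤ 𝒲)
    (hW : ∀ i ∈ range T, ∑ h ∈ Icc 1 H, ∑ c ∈ (range h).filter (fun c => c.Coprime h), ‖W i h c‖ ^ 2 ≤ 𝒲 ^ 2)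
    (F : ℕ → ℕ → ℂ) (Φ : ℕ → ℝ) (hF : ∀ i ∈ range T, ∀ q ∈ G, ‖F i q‖ ≤ Φ q) :
    ‖∑ i ∈ range T, ∑ h ∈ Icc 1 H, ∑ c ∈ (range h).filter (fun c => c.Coprime h),
        W i h c * levelLargePart R (G.filter
          (fun q : ℕ => q ∈ Ioc (N₀ + i * N₀ / T) (N₀ + (i + 1) * N₀ / T))) (F i) h (c : ZMod h)‖ ≤
      𝒲 * ((1 + Real.log H) * Real.sqrt (2 * ((((N₀ / T + 1 : ℕ)) : ℝ) + 1) / R + 4 * H)) *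
        Real.sqrt T * Real.sqrt (∑ q ∈ G, Φ q ^ 2) := by
  exact norm_sum_blocks_moduli_coprime_mul_levelLargePart_le hR (coprime_moduli_of_subset_primes G hG hH).1
    (coprime_moduli_of_subset_primes G hG hH).2 hT W h𝒲 hW F Φ hF

end LargeSieveBlocks

/-! ### Rev 2 (append, line lead KEYS 17:00Z «prover-4 = OffDiagLevelSubBlocks … stated for a general finite family so
L7d imports it»): the mean square over all blocks (no `√T` before Cauchy–Schwarz) and the INDEX form with multiplicity -/

section LargeSieveBlocksIndex

variable {M₀ N T R H : ℕ} {G : Finset ℕ}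

/-- **Mean square of the large-conductor parts, all blocks, moduli and classes**: for block-dependent level weights
`‖F_i(q)‖ ≤ Φ(q)` on `G ⊆ (M₀, M₀+N]` (coprime to all moduli `≤ H`), `1 ≤ R`, `1 ≤ T`:
`Σ_{i<T} Σ_{h ≤ H} Σ_{c < h, (c,h)=1} ‖levelLargePart R (G∩B_i) F_i h c‖² ≤ (1 + log H)²(2((N/T+1)+1)/R + 4H)·Σ_{q∈G} Φ(q)²`
— the `ℓ²` form across the blocks: the `√T` of `norm_sum_blocks_moduli_coprime_mul_levelLargePart_le` appears only when
`Σ_i ‖W_i‖₂²` is bounded by `T·max_i ‖W_i‖₂²`. [cite: Davenport1980, ch. 29 — derivation] -/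
theorem sum_blocks_moduli_sum_coprime_norm_sq_levelLargePart_le (hR : 1 ≤ R) (hG : G ⊆ Ioc M₀ (M₀ + N))
    (hcop : ∀ q ∈ G, ∀ h ∈ Icc 1 H, Nat.Coprime q h) (hT : 1 ≤ T) (F : ℕ → ℕ → ℂ) (Φ : ℕ → ℝ)
    (hF : ∀ i ∈ range T, ∀ q ∈ G, ‖F i q‖ ≤ Φ q) :
    ∑ i ∈ range T, ∑ h ∈ Icc 1 H, ∑ c ∈ (range h).filter (fun c => c.Coprime h),
        ‖levelLargePart R (G.filter
          (fun q : ℕ => q ∈ Ioc (M₀ + i * N / T) (M₀ + (i + 1) * N / T))) (F i) h (c : ZMod h)‖ ^ 2 ≤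
      (1 + Real.log H) ^ 2 * (2 * ((((N / T + 1 : ℕ)) : ℝ) + 1) / R + 4 * H) * ∑ q ∈ G, Φ q ^ 2 := by
  classical
  have hlog : 0 ≤ 1 + Real.log H := by have := Real.log_natCast_nonneg H; linarith
  have hC : 0 ≤ (1 + Real.log H) ^ 2 * (2 * ((((N / T + 1 : ℕ)) : ℝ) + 1) / R + 4 * H) := by positivity
  calc ∑ i ∈ range T, ∑ h ∈ Icc 1 H, ∑ c ∈ (range h).filter (fun c => c.Coprime h),
        ‖levelLargePart R (G.filter
          (fun q : ℕ => q ∈ Ioc (M₀ + i * N / T) (M₀ + (i + 1) * N / T))) (F i) h (c : ZMod h)‖ ^ 2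
      ≤ ∑ i ∈ range T, (1 + Real.log H) ^ 2 * (2 * ((((N / T + 1 : ℕ)) : ℝ) + 1) / R + 4 * H) *
          ∑ q ∈ G.filter (fun q : ℕ => q ∈ Ioc (M₀ + i * N / T) (M₀ + (i + 1) * N / T)), Φ q ^ 2 := by
        refine Finset.sum_le_sum fun i hi => ?_
        refine (sum_moduli_sum_coprime_norm_sq_levelLargePart_le _ (F i) hR (filter_block_subset_Ioc G M₀ N T i)
          (coprime_of_filter_block hcop _)).trans ?_
        refine mul_le_mul_of_nonneg_left (Finset.sum_le_sum fun q hq => ?_) hC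
        exact pow_le_pow_left₀ (norm_nonneg _) (hF i hi q (Finset.mem_filter.1 hq).1) 2
    _ = (1 + Real.log H) ^ 2 * (2 * ((((N / T + 1 : ℕ)) : ℝ) + 1) / R + 4 * H) * ∑ q ∈ G, Φ q ^ 2 := by
        rw [← Finset.mul_sum, ← sum_eq_sum_blocks_filter hG hT]

/-- **E18 block by block, index form with multiplicity** (the family form L7d imports): a finite family `x ∈ X` of
(modulus, class-representative) pairs `(md x, cl x)`, `1 ≤ md x ≤ H`, `cl x < md x`, `(cl x, md x) = 1`, a flatness
count `m(h) ≥ #{x : md x = h, cl x = c}` (L7b `OffDiagFlatnessCount`), block-dependent weights `w_i(x)` with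
`Σ_x m(md x)‖w_i(x)‖² ≤ 𝒲²` for every block, block-dependent level weights `‖F_i‖ ≤ Φ` on `G ⊆ (M₀, M₀+N]` (coprime
to all moduli `≤ H`), `1 ≤ R`, `1 ≤ T`:
`‖Σ_{i<T} Σ_{x∈X} w_i(x)·levelLargePart R (G∩B_i) F_i (md x) (cl x)‖
   ≤ 𝒲·(1 + log H)·(2((N/T+1)+1)/R + 4H)^{1/2}·√T·(Σ_{q∈G} Φ(q)²)^{1/2}`
— with `T = ⌈2Z q^{ε}⌉` blocks of length `≍ N/(Zq^{ε})` this is the deviation bound of the oscillatory layers with the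
explicit `(2Zq^{ε})^{1/2}` loss (per block: `norm_sum_mul_levelLargePart_le_of_multiplicity`).
[cite: Davenport1980, ch. 29 — derivation; IwaniecKowalski2004, §17.3 — derivation] -/
theorem norm_sum_blocks_mul_levelLargePart_le_of_multiplicity (hR : 1 ≤ R) (hG : G ⊆ Ioc M₀ (M₀ + N))
    (hcop : ∀ q ∈ G, ∀ h ∈ Icc 1 H, Nat.Coprime q h) (hT : 1 ≤ T) {ι : Type*} (X : Finset ι)
    (md cl : ι → ℕ) (hX : ∀ x ∈ X, md x ∈ Icc 1 H ∧ cl x < md x ∧ (cl x).Coprime (md x)) (m : ℕ → ℝ)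
    (hm : ∀ h ∈ Icc 1 H, ∀ c : ℕ, ((X.filter (fun x => md x = h ∧ cl x = c)).card : ℝ) ≤ m h)
    (w : ℕ → ι → ℂ) {𝒲 : ℝ} (h𝒲 : 0 ≤ 𝒲) (hw : ∀ i ∈ range T, ∑ x ∈ X, m (md x) * ‖w i x‖ ^ 2 ≤ 𝒲 ^ 2)
    (F : ℕ → ℕ → ℂ) (Φ : ℕ → ℝ) (hF : ∀ i ∈ range T, ∀ q ∈ G, ‖F i q‖ ≤ Φ q) :
    ‖∑ i ∈ range T, ∑ x ∈ X, w i x * levelLargePart R (G.filter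
        (fun q : ℕ => q ∈ Ioc (M₀ + i * N / T) (M₀ + (i + 1) * N / T))) (F i) (md x) (cl x : ZMod (md x))‖ ≤
      𝒲 * ((1 + Real.log H) * Real.sqrt (2 * ((((N / T + 1 : ℕ)) : ℝ) + 1) / R + 4 * H)) *
        Real.sqrt T * Real.sqrt (∑ q ∈ G, Φ q ^ 2) := by
  classical
  have hlog : 0 ≤ 1 + Real.log H := by have := Real.log_natCast_nonneg H; linarith
  have hA : 0 ≤ 𝒲 * ((1 + Real.log H) * Real.sqrt (2 * ((((N / T + 1 : ℕ)) : ℝ) + 1) / R + 4 * H)) := by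
    positivity
  refine norm_sum_blocks_le hG hT hA Φ fun i hi => ?_
  set Gi := G.filter (fun q : ℕ => q ∈ Ioc (M₀ + i * N / T) (M₀ + (i + 1) * N / T)) with hGi
  have h1 := norm_sum_mul_levelLargePart_le_of_multiplicity Gi (F i) hR (filter_block_subset_Ioc G M₀ N T i)
    (coprime_of_filter_block hcop _) X md cl (w i) hX m hm
  have h2 : Real.sqrt (∑ x ∈ X, m (md x) * ‖w i x‖ ^ 2) ≤ 𝒲 := by
    rw [← Real.sqrt_sq h𝒲]
    exact Real.sqrt_le_sqrt (hw i hi)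
  have h3 : Real.sqrt (∑ q ∈ Gi, ‖F i q‖ ^ 2) ≤ Real.sqrt (∑ q ∈ Gi, Φ q ^ 2) := by
    refine Real.sqrt_le_sqrt (Finset.sum_le_sum fun q hq => ?_)
    exact pow_le_pow_left₀ (norm_nonneg _) (hF i hi q (Finset.mem_filter.1 hq).1) 2
  have hc0 : 0 ≤ (1 + Real.log H) * Real.sqrt (2 * ((((N / T + 1 : ℕ)) : ℝ) + 1) / R + 4 * H) := by
    positivity
  refine h1.trans ?_
  calc Real.sqrt (∑ x ∈ X, m (md x) * ‖w i x‖ ^ 2) *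
        ((1 + Real.log H) * Real.sqrt (2 * ((((N / T + 1 : ℕ)) : ℝ) + 1) / R + 4 * H) *
          Real.sqrt (∑ q ∈ Gi, ‖F i q‖ ^ 2))
      ≤ 𝒲 * ((1 + Real.log H) * Real.sqrt (2 * ((((N / T + 1 : ℕ)) : ℝ) + 1) / R + 4 * H) *
          Real.sqrt (∑ q ∈ Gi, Φ q ^ 2)) :=
        mul_le_mul h2 (mul_le_mul_of_nonneg_left h3 hc0) (by positivity) h𝒲
    _ = 𝒲 * ((1 + Real.log H) * Real.sqrt (2 * ((((N / T + 1 : ℕ)) : ℝ) + 1) / R + 4 * H)) *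
          Real.sqrt (∑ q ∈ Gi, Φ q ^ 2) := by ring

/-- **Prime levels, index form, block by block**: `G ⊆` primes of `(N₀, 2N₀]`, moduli `≤ H ≤ N₀`, `1 ≤ R`, `1 ≤ T`,
blocks of `(N₀, 2N₀]`; otherwise as `norm_sum_blocks_mul_levelLargePart_le_of_multiplicity`.
[cite: Davenport1980, ch. 29 — derivation; IwaniecKowalski2004, §17.3 — derivation] -/
theorem norm_sum_blocks_mul_levelLargePart_le_of_multiplicity_of_subset_primes {N₀ : ℕ} (hR : 1 ≤ R)
    (hG : G ⊆ (Ioc N₀ (2 * N₀)).filter Nat.Prime) (hH : H ≤ N₀) (hT : 1 ≤ T) {ι : Type*} (X : Finset ι)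
    (md cl : ι → ℕ) (hX : ∀ x ∈ X, md x ∈ Icc 1 H ∧ cl x < md x ∧ (cl x).Coprime (md x)) (m : ℕ → ℝ)
    (hm : ∀ h ∈ Icc 1 H, ∀ c : ℕ, ((X.filter (fun x => md x = h ∧ cl x = c)).card : ℝ) ≤ m h)
    (w : ℕ → ι → ℂ) {𝒲 : ℝ} (h𝒲 : 0 ≤ 𝒲) (hw : ∀ i ∈ range T, ∑ x ∈ X, m (md x) * ‖w i x‖ ^ 2 ≤ 𝒲 ^ 2)
    (F : ℕ → ℕ → ℂ) (Φ : ℕ → ℝ) (hF : ∀ i ∈ range T, ∀ q ∈ G, ‖F i q‖ ≤ Φ q) :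
    ‖∑ i ∈ range T, ∑ x ∈ X, w i x * levelLargePart R (G.filter
        (fun q : ℕ => q ∈ Ioc (N₀ + i * N₀ / T) (N₀ + (i + 1) * N₀ / T))) (F i) (md x) (cl x : ZMod (md x))‖ ≤
      𝒲 * ((1 + Real.log H) * Real.sqrt (2 * ((((N₀ / T + 1 : ℕ)) : ℝ) + 1) / R + 4 * H)) *
        Real.sqrt T * Real.sqrt (∑ q ∈ G, Φ q ^ 2) :=
  norm_sum_blocks_mul_levelLargePart_le_of_multiplicity hR (coprime_moduli_of_subset_primes G hG hH).1
    (coprime_moduli_of_subset_primes G hG hH).2 hT X md cl hX m hm w h𝒲 hw F Φ hF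

end LargeSieveBlocksIndex

end Summit.Parity.GeneralizedHardyLittlewood.Theorems.BeyondDiagonalBeatsQuarter.OffDiag
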